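import Mathlib
import Summits.Ventures.PercRepro2.SixTerminal
import Summits.Ventures.PercRepro2.SixTerminalLocus

/-!
# THEOREM 31 on every six-vertex marked graph, any edge type, any labelling: the equality locus of
(HCOV) read off the support mask (blind cell PercRepro2, mine-2 g33)

A loop-free graph on exactly six vertices (parallel edges allowed) with a bijection
`ι : V ≃ Fin 6` is a block substitution of `K₆` in which every edge is its own block
(`card6Blk`, `isBlockSubst_card6` — the construction inside `HCov_card6`, exposed).  The weight
of the block `j` is `1 − ∏ (1 − p e)` over the edges `e` of `j` (`bsProb_card6`: the block is
open iff one of its edges is, `bsOpen_card6_iff`), so for weights in `[0, 1)` the skeleton mask of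
`SixTerminalLocus.lean` is the **support mask** `M` — the pairs `{ι x, ι y}` carrying an edge of
positive weight — and THEOREM 31 reads:

* **`gc_card6_pos_iff`**: `0 < Gc` iff `K₆(M)` is in none of the lead's five classes;
* **`gc_card6_zero_iff`**: `Gc = 0` iff `K₆(M)` is in one of them.

THEOREM 31 (`Deg5.Locus.gc15_pos_iff` / `gc15_zero_iff`) was stated on the fixed type
`Fin 15 → R` with the marks at `(0, 1, 2, 5, 4)`; here it holds for any edge type (parallel edges
allowed) and any labelling of the five marks (`ι`), with weights in `[0, 1)` (a weight `1`
contracts an edge and is not covered).  Standard axioms only.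
-/

namespace Summit.Ventures.PercRepro2

namespace BlockSubst

section Card6Blocks

open Deg5 Deg5.Locus

variable {V : Type*} {E : Type*}

/-- Every edge its own block: the block of an edge is the `K₆`-index of its image under `ι`. -/
def card6Blk (ι : V ≃ Fin 6) (ends : E → Sym2 V) (e : E) : Fin 15 :=
  Sym2.lift ⟨fun x y => idx6 (ι x) (ι y), fun x y => idx6_comm (ι x) (ι y)⟩ (ends e)

/-- The vertex set of the block `j`: its two terminals. -/
def card6Vj (ι : V ≃ Fin 6) (j : Fin 15) : Set V := {x | ∃ k ∈ ends15 j, x = ι.symm k}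

/-- The `K₆`-edge of an edge's block is the image of the edge. -/
lemma ends15_card6Blk (ι : V ≃ Fin 6) (ends : E → Sym2 V) (hloop : ∀ e, ¬ (ends e).IsDiag)
    (e : E) : ends15 (card6Blk ι ends e) = (ends e).map ι := by
  have hne := hloop e
  revert hne
  unfold card6Blk
  induction ends e using Sym2.ind with
  | h x₀ y₀ =>
    intro hne
    rw [Sym2.mk_isDiag_iff] at hne
    rw [Sym2.lift_mk, Sym2.map_mk]
    exact ends15_idx6 _ _ fun h => hne (ι.injective h)

/-- **A loop-free six-vertex graph is a block substitution of `K₆`**, every edge its own block. -/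
theorem isBlockSubst_card6 (ι : V ≃ Fin 6) (ends : E → Sym2 V) (hloop : ∀ e, ¬ (ends e).IsDiag) :
    IsBlockSubst ends ends15 ι.symm (card6Blk ι ends) (card6Vj ι) where
  ends_mem e x hx := by
    refine ⟨ι x, ?_, (ι.symm_apply_apply x).symm⟩
    rw [ends15_card6Blk ι ends hloop e, Sym2.mem_map]
    exact ⟨x, hx, rfl⟩
  term_mem j k hk := ⟨k, hk, rfl⟩
  inter_terms _ _ _ _ hx _ := hx
  term_only j k hk := by
    obtain ⟨k', hk', hkk'⟩ := hk
    rw [ι.symm.injective hkk']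
    exact hk'
  q_inj := ι.symm.injective

variable [Fintype E] [DecidableEq E]

omit [Fintype E] [DecidableEq E] in
/-- An edge of the block `j` joins the two terminals of `j`. -/
lemma ends_eq_of_card6Blk (ι : V ≃ Fin 6) (ends : E → Sym2 V) (hloop : ∀ e, ¬ (ends e).IsDiag)
    {e : E} {j : Fin 15} (he : card6Blk ι ends e = j) {x y : Fin 6} (hj : ends15 j = s(x, y)) :
    ends e = s(ι.symm x, ι.symm y) := by
  have h := ends15_card6Blk ι ends hloop e
  rw [he, hj] at h
  have h' := congrArg (Sym2.map ι.symm) h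
  rw [Sym2.map_map, Sym2.map_mk] at h'
  have : (ι.symm ∘ ι) = id := by ext x; simp
  rw [this, Sym2.map_id] at h'
  exact h'.symm

omit [DecidableEq E] in
/-- **The block `j` is open iff one of its edges is open.** -/
lemma bsOpen_card6_iff (ι : V ≃ Fin 6) (ends : E → Sym2 V) (hloop : ∀ e, ¬ (ends e).IsDiag)
    (ω : Config E) (j : Fin 15) :
    bsOpen ends ends15 ι.symm (card6Blk ι ends) ω j = true ↔
      ∃ e, card6Blk ι ends e = j ∧ ω e = true := by
  rw [bsOpen_eq_true_iff]
  constructor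
  · intro h
    have hj := ea_ne_eb j
    rw [ea_eq, eb_eq] at hj
    have hne : (edge15 j).1 ≠ (edge15 j).2 := fun h' => hj (by rw [h'])
    have hc := h (edge15 j).1 (edge15 j).2 rfl
    by_contra hno
    have hno' : ∀ e, card6Blk ι ends e = j → ω e ≠ true := fun e he h => hno ⟨e, he, h⟩
    -- with no open edge in the block, `{ι.symm (edge15 j).1}` is closed under open adjacency
    have hclosed : ∀ x ∈ ({ι.symm (edge15 j).1} : Set V), ∀ y,
        (openGraph ends (blockCfg (card6Blk ι ends) j ω)).Adj x y →
          y ∈ ({ι.symm (edge15 j).1} : Set V) := by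
      intro x _ y hxy
      rw [openGraph_adj] at hxy
      obtain ⟨_, e, he, _⟩ := hxy
      obtain ⟨he1, he2⟩ := of_blockCfg_eq_true he
      exact absurd he1 (hno' e he2)
    have := mem_of_conn_of_closed hclosed (Set.mem_singleton _) hc
    rw [Set.mem_singleton_iff] at this
    exact hne (ι.symm.injective this).symm
  · rintro ⟨e, he, hω⟩ x y hj
    have hends := ends_eq_of_card6Blk ι ends hloop he hj
    exact conn_of_openAdj ⟨e, blockCfg_apply_of_eq hω he, hends⟩

variable {R : Type*} [Field R] [LinearOrder R] [IsStrictOrderedRing R]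

omit [LinearOrder R] [IsStrictOrderedRing R] in
/-- **The block weights of a six-vertex graph**: `1 − ∏ (1 − p e)` over the edges of the block. -/
lemma bsProb_card6 (ι : V ≃ Fin 6) (ends : E → Sym2 V) (hloop : ∀ e, ¬ (ends e).IsDiag)
    (p : E → R) (j : Fin 15) :
    bsProb ends ends15 ι.symm (card6Blk ι ends) p j =
      1 - ∏ e ∈ Finset.univ.filter (fun e => card6Blk ι ends e = j), (1 - p e) := by
  have : {ω : Config E | bsOpen ends ends15 ι.symm (card6Blk ι ends) ω j = true} =
      (allClosed (Finset.univ.filter fun e => card6Blk ι ends e = j))ᶜ := by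
    ext ω
    rw [Set.mem_setOf_eq, bsOpen_card6_iff ι ends hloop, Set.mem_compl_iff, mem_allClosed]
    simp only [Finset.mem_filter, Finset.mem_univ, true_and, not_forall, Bool.not_eq_false]
    exact ⟨fun ⟨e, he, hω⟩ => ⟨e, he, hω⟩, fun ⟨e, he, hω⟩ => ⟨e, he, hω⟩⟩
  rw [bsProb, this, prob_compl, prob_allClosed]

/-- A block with an edge of positive weight, all weights below `1`, has weight in `(0, 1)`. -/
lemma bsProb_card6_mem_Ioo (ι : V ≃ Fin 6) (ends : E → Sym2 V) (hloop : ∀ e, ¬ (ends e).IsDiag)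
    (p : E → R) (hp : ∀ e, 0 ≤ p e ∧ p e < 1) (j : Fin 15) {e₀ : E} (he₀ : card6Blk ι ends e₀ = j)
    (hpos : 0 < p e₀) :
    0 < bsProb ends ends15 ι.symm (card6Blk ι ends) p j ∧
      bsProb ends ends15 ι.symm (card6Blk ι ends) p j < 1 := by
  rw [bsProb_card6 ι ends hloop]
  set s := Finset.univ.filter (fun e => card6Blk ι ends e = j) with hs
  have he₀s : e₀ ∈ s := by simp [hs, he₀]
  constructor
  · rw [sub_pos, ← Finset.mul_prod_erase s _ he₀s]
    calc (1 - p e₀) * ∏ x ∈ s.erase e₀, (1 - p x) ≤ (1 - p e₀) * 1 := by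
          apply mul_le_mul_of_nonneg_left _ (by linarith [(hp e₀).2])
          exact Finset.prod_le_one (fun e _ => by linarith [(hp e).2])
            (fun e _ => by linarith [(hp e).1])
      _ < 1 := by rw [mul_one]; linarith
  · rw [sub_lt_self_iff]
    exact Finset.prod_pos fun e _ => by linarith [(hp e).2]

omit [LinearOrder R] [IsStrictOrderedRing R] in
/-- A block whose edges all have weight `0` has weight `0`. -/
lemma bsProb_card6_eq_zero (ι : V ≃ Fin 6) (ends : E → Sym2 V) (hloop : ∀ e, ¬ (ends e).IsDiag)
    (p : E → R) (j : Fin 15) (h0 : ∀ e, card6Blk ι ends e = j → p e = 0) :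
    bsProb ends ends15 ι.symm (card6Blk ι ends) p j = 0 := by
  rw [bsProb_card6 ι ends hloop, sub_eq_zero]
  symm
  apply Finset.prod_eq_one
  intro e he
  rw [Finset.mem_filter] at he
  rw [h0 e he.2, sub_zero]

/-- **THEOREM 31 on every six-vertex marked graph, any edge type, any labelling — positive
side**: weights in `[0, 1)`, `M` the support mask (`M.testBit j` iff some edge of the block `j`
has positive weight); `0 < Gc` at the marks `ι⁻¹ 0, ι⁻¹ 1, ι⁻¹ 2, ι⁻¹ 5, ι⁻¹ 4` iff `K₆(M)` is in
none of the lead's five classes. -/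
theorem gc_card6_pos_iff (ι : V ≃ Fin 6) (ends : E → Sym2 V) (hloop : ∀ e, ¬ (ends e).IsDiag)
    (p : E → R) (hp : ∀ e, 0 ≤ p e ∧ p e < 1) (M : ℕ) (hM : M < 32768)
    (hMdef : ∀ j : Fin 15, M.testBit j = true ↔ ∃ e, card6Blk ι ends e = j ∧ 0 < p e) :
    0 < CovForm.Gc p ends (ι.symm 0) (ι.symm 1) (ι.symm 2) (ι.symm 5) (ι.symm 4) ↔
      FiveClass15 M = false := by
  refine gc_sixTerminal_pos_iff (isBlockSubst_card6 ι ends hloop) p M hM ?_ ?_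
  · intro j hj
    obtain ⟨e₀, he₀, hpos⟩ := (hMdef j).1 hj
    exact bsProb_card6_mem_Ioo ι ends hloop p hp j he₀ hpos
  · intro j hj
    refine bsProb_card6_eq_zero ι ends hloop p j fun e he => ?_
    by_contra hne
    have hpos : 0 < p e := lt_of_le_of_ne (hp e).1 (Ne.symm hne)
    have := (hMdef j).2 ⟨e, he, hpos⟩
    rw [hj] at this
    exact Bool.false_ne_true this

/-- **THEOREM 31 on every six-vertex marked graph, any edge type, any labelling — zero side**:
with `M` the support mask as above, `Gc = 0` iff `K₆(M)` is in one of the five classes. -/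
theorem gc_card6_zero_iff (ι : V ≃ Fin 6) (ends : E → Sym2 V) (hloop : ∀ e, ¬ (ends e).IsDiag)
    (p : E → R) (hp : ∀ e, 0 ≤ p e ∧ p e < 1) (M : ℕ) (hM : M < 32768)
    (hMdef : ∀ j : Fin 15, M.testBit j = true ↔ ∃ e, card6Blk ι ends e = j ∧ 0 < p e) :
    CovForm.Gc p ends (ι.symm 0) (ι.symm 1) (ι.symm 2) (ι.symm 5) (ι.symm 4) = 0 ↔
      FiveClass15 M = true := by
  refine gc_sixTerminal_zero_iff (isBlockSubst_card6 ι ends hloop) p M hM ?_ ?_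
  · intro j hj
    obtain ⟨e₀, he₀, hpos⟩ := (hMdef j).1 hj
    exact bsProb_card6_mem_Ioo ι ends hloop p hp j he₀ hpos
  · intro j hj
    refine bsProb_card6_eq_zero ι ends hloop p j fun e he => ?_
    by_contra hne
    have hpos : 0 < p e := lt_of_le_of_ne (hp e).1 (Ne.symm hne)
    have := (hMdef j).2 ⟨e, he, hpos⟩
    rw [hj] at this
    exact Bool.false_ne_true this

end Card6Blocks

end BlockSubst

end Summit.Ventures.PercRepro2
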